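import Summits.QuantumFields.YangMills.Theorems.FluctuationComparisonRegPrIntLWregGlue
import Summits.QuantumFields.YangMills.Theorems.FluctuationComparisonRegPrIntLS2BetaBlindDensityUniqueness
import HarnessLib

/-!
# S2β · LINE g18-1 · DET-REP-B‴∘ ∕ JACW — (J-PIN) brick 2: TWO FIBRED-CHART LAWS OF THE SAME MEASURE HAVE A.E.-EQUAL JACOBIANS
# (a window chart's `jac` is pinned, `μ_J⌊O ⊗ ν_K`-almost everywhere, by ANY second chart law of the pivot-moving kind)

Cell `ym3-torus` (rung R3: continuum `SU(2)` Yang–Mills on `T³` — NOT `d = 4`, NOT infinite volume, NOT a mass gap, NOT Clay); width seat `ym-ust-20520-w5` g16;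
helper of the crux `stmt-QuantumFields-20520` (`--supports … --as helper`, NOT a proof of it).  Road (R1) of FINDING #41 §3 (evidence on 20520).

THE POINT.  `def DetRepB`‴∘'s JACW-ROW reads `c.jac` for EVERY `c : WindowChart …` with the chart rows; the product formula is known for the explicit chart of
✓`…S2BetaChartJacProduct.exists_fibredChart_iter_cont_blind_prod` (✓p761834).  A fibred-chart LAW `μ_K⌊(D⁻¹O ∩ S) = ((μ_J⌊O ⊗ ν_K)·F) ∘ Ψ⁻¹` whose chart map `Ψ`
MOVES ONLY THE PIVOTS (`Ψ (V, z) = z[β c ↦ …]`) and LANDS IN THE FIBRE (`D (Ψ (V, z)) = V`) wherever `F ≠ 0` determines, for every measurable set `W` BLIND to the pivot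
coordinates, `∫_W F d(μ_J⌊O ⊗ ν_K) = μ_K {U ∈ D⁻¹O ∩ S | (D U, U) ∈ W}` (§1: test the law on `E := {U | (D U, U) ∈ W}` — on the live set `1_E ∘ Ψ = 1_W`).  Hence TWO such
laws for the same `(D, O, S)` give densities with equal integrals on every blind set, and if both densities are blind and one has finite integral they are
A.E. EQUAL (§2, by ✓brick 1 `…S2BetaBlindDensityUniqueness.ae_eq_of_setLIntegral_eq_of_extendBlind`, ✓p762333).  §3 instantiates the first law with a
`WindowChart`'s own fields (`map_Φ`, `descendTo_Φ`, `jac_le`) and the off-pivot ∕ pivot-blind clauses of `ChartRows`∕`ChartRowsJ` (as hypotheses, tree vocabulary),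
the second with ANY `(Ψ̂, Ĝ)` of the same kind — e.g. the explicit product chart transported to the window level by
✓`…WregFibredChart.fibredLaw_transport` (`Ĝ = 1_{S}(Φ̂(e′V, z))·Ĵ(e′V, z)`, `Ĵ = 1_{windows}·Π_c jd c z (V c)`): ★★★`windowChart_jac_ae_eq`.
What remains for (J-PIN) after this file: from a.e. to the POINT `(V₀, U*)` (the `regular` field + Haar open-positivity + carrier continuity) — brick 3, not here.
HONEST SCOPE.  Measure bookkeeping (`map_apply`, `withDensity_apply`, one `lintegral_congr_ae`); def-free; default heartbeats; proves nothing of BRD, DETN∕JACW's value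
bound, DET-REP-B‴∘, S2β or the crux 20520; `YM3TorusSU2` NOT proved; the Yang–Mills mass gap (Clay) NOT proved.
[cite: Balaban1987RG1, (0.4) p.253 and (2.10) p.267] [cite: Bogachev2007, Thm 2.5.3 and §3.6 (images of measures)]
-/

set_option autoImplicit false

noncomputable section

open MeasureTheory Filter Topology Set Function
open scoped ENNReal NNReal
open Literature.MathematicalPhysics.QuantumFieldTheory.Balaban1983to89
open Literature.MathematicalPhysics.QuantumFieldTheory.Balaban1983to89.T3ContinuumYM3Torus
open Literature.MathematicalPhysics.QuantumFieldTheory.Balaban1983to89.T3NestedUnitLaws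
open Literature.MathematicalPhysics.QuantumFieldTheory.Balaban1983to89.T3UnitLawDensityEML
open Literature.MathematicalPhysics.QuantumFieldTheory.Balaban1983to89.T3UnitScaleTilt
open Literature.MathematicalPhysics.QuantumFieldTheory.Balaban1983to89.T3TiltDescent
open Literature.MathematicalPhysics.QuantumFieldTheory.Balaban1983to89.T3LevelShift
open Literature.MathematicalPhysics.QuantumFieldTheory.Balaban1983to89.T4Continuum
open scoped Literature.MathematicalPhysics.QuantumFieldTheory.Balaban1983to89.T3OrbitAverage

namespace Summit.QuantumFields.YangMills.Theorems.FluctuationComparisonRegPrIntLS2BetaChartJacPinningAE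

open Summit.QuantumFields.YangMills.Theorems.FluctuationComparisonRegPrIntLS2BetaBlindDensityUniqueness (ae_eq_of_setLIntegral_eq_of_extendBlind)

/-! ## §1 A pivot-moving fibred-chart law tested on a pivot-blind set -/

section Abstract

variable {Y Bd G κ : Type*} [MeasurableSpace Y] [MeasurableSpace (Bd → G)]

/-- ★★ **A PIVOT-MOVING FIBRED-CHART LAW, TESTED ON A BLIND SET.**  Let `ρ = (M·F) ∘ Ψ⁻¹` (`M` a measure on `Y × (Bd → G)`, `F` a measurable `ℝ≥0∞` density,
`Ψ` measurable) where, for `M`-a.e. `p` with `F p ≠ 0`, the chart lands in the fibre (`D (Ψ p) = p.1`) and moves only the pivots (`Ψ p = extend β h p.2` for some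
`h`).  Then for every measurable `W` blind to the pivots, `∫_W F dM = ρ {U | (D U, U) ∈ W}`. [cite: Bogachev2007, §3.6] [cite: Balaban1987RG1, (2.10) p.267] -/
theorem setLIntegral_eq_measure_of_law {M : Measure (Y × (Bd → G))} {ρ : Measure (Bd → G)} {D : (Bd → G) → Y} (hD : Measurable D)
    (β : κ → Bd) {Ψ : Y × (Bd → G) → (Bd → G)} {F : Y × (Bd → G) → ℝ≥0∞} (hΨ : Measurable Ψ)
    (hlaw : ρ = (M.withDensity F).map Ψ)
    (hfib : ∀ᵐ p ∂M, F p ≠ 0 → D (Ψ p) = p.1) (hpiv : ∀ᵐ p ∂M, F p ≠ 0 → ∃ h : κ → G, Ψ p = extend β h p.2)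
    {W : Set (Y × (Bd → G))} (hW : MeasurableSet W) (hWbl : ∀ (h : κ → G) (p : Y × (Bd → G)), (p.1, extend β h p.2) ∈ W ↔ p ∈ W) :
    ∫⁻ p in W, F p ∂M = ρ {U | (D U, U) ∈ W} := by
  have hEm : MeasurableSet {U : Bd → G | (D U, U) ∈ W} := (hD.prodMk measurable_id) hW
  rw [hlaw, Measure.map_apply hΨ hEm, withDensity_apply _ (hΨ hEm), ← lintegral_indicator hW, ← lintegral_indicator (hΨ hEm)]
  refine lintegral_congr_ae ?_
  filter_upwards [hfib, hpiv] with p hf hp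
  by_cases hF0 : F p = 0
  · simp only [Set.indicator, hF0]
    split_ifs <;> rfl
  · obtain ⟨h, hh⟩ := hp hF0
    have hiff : p ∈ W ↔ p ∈ Ψ ⁻¹' {U : Bd → G | (D U, U) ∈ W} := by
      rw [mem_preimage, mem_setOf_eq, hf hF0, hh]
      exact (hWbl h p).symm
    by_cases hpW : p ∈ W
    · rw [Set.indicator_of_mem hpW, Set.indicator_of_mem (hiff.1 hpW)]
    · rw [Set.indicator_of_notMem hpW, Set.indicator_of_notMem (fun hq => hpW (hiff.2 hq))]

/-! ## §2 Two laws, one measure: the densities agree almost everywhere -/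

/-- ★★ **TWO PIVOT-MOVING FIBRED-CHART LAWS OF THE SAME MEASURE HAVE A.E.-EQUAL DENSITIES.**  If `(M·F) ∘ Ψ⁻¹ = ρ = (M·G) ∘ Ψ′⁻¹` with both charts landing in the
fibre and moving only the pivots where their densities live, both densities BLIND to the pivots, and `∫ F dM < ∞`, then `F = G` `M`-a.e. — §1 twice and ✓brick 1.
[cite: Bogachev2007, Thm 2.5.3 and §3.6] [cite: Balaban1987RG1, (2.10) p.267] -/
theorem ae_eq_of_two_laws {M : Measure (Y × (Bd → G))} {ρ : Measure (Bd → G)} {D : (Bd → G) → Y} (hD : Measurable D) (β : κ → Bd)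
    {Ψ Ψ' : Y × (Bd → G) → (Bd → G)} {F G' : Y × (Bd → G) → ℝ≥0∞} (hΨ : Measurable Ψ) (hΨ' : Measurable Ψ') (hF : Measurable F) (hG : Measurable G')
    (hlaw : ρ = (M.withDensity F).map Ψ) (hlaw' : ρ = (M.withDensity G').map Ψ')
    (hfib : ∀ᵐ p ∂M, F p ≠ 0 → D (Ψ p) = p.1) (hpiv : ∀ᵐ p ∂M, F p ≠ 0 → ∃ h : κ → G, Ψ p = extend β h p.2)
    (hfib' : ∀ᵐ p ∂M, G' p ≠ 0 → D (Ψ' p) = p.1) (hpiv' : ∀ᵐ p ∂M, G' p ≠ 0 → ∃ h : κ → G, Ψ' p = extend β h p.2)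
    (hFbl : ∀ (h : κ → G) (p : Y × (Bd → G)), F (p.1, extend β h p.2) = F p) (hGbl : ∀ (h : κ → G) (p : Y × (Bd → G)), G' (p.1, extend β h p.2) = G' p)
    (hfin : ∫⁻ p, F p ∂M ≠ ∞) :
    F =ᵐ[M] G' :=
  ae_eq_of_setLIntegral_eq_of_extendBlind β hF hG hFbl hGbl hfin fun W hW hWbl => by
    rw [setLIntegral_eq_measure_of_law hD β hΨ hlaw hfib hpiv hW hWbl, setLIntegral_eq_measure_of_law hD β hΨ' hlaw' hfib' hpiv' hW hWbl]

end Abstract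

/-! ## §3 The window chart: its Jacobian is pinned a.e. by any pivot-moving chart law of the same restricted Haar measure -/

section Window

variable (F : T3Family) {J K : ℕ} (hJK : J ≤ K)

/-- ★★★ **A WINDOW CHART'S JACOBIAN IS PINNED `μ_J⌊O ⊗ ν_K`-A.E.**  Let `c : WindowChart F hJK S O` (`O`, `S` measurable) satisfy, in the tree's letters, the OFF-PIVOT
IDENTITY on its live set (`c.jac (V,z) ≠ 0 → c.Φ (V,z) b = z b` off the pivots `β`; a `ChartRows` clause) and PIVOT-BLINDNESS of `c.jac` (a `ChartRowsJ` clause), and let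
`(Ψ̂, Ĝ)` be ANY measurable pair with the same law `μ_K⌊(D⁻¹O ∩ S) = ((μ_J⌊O ⊗ ν_K)·Ĝ) ∘ Ψ̂⁻¹`, landing in the fibre and moving only the pivots where `Ĝ ≠ 0`, `Ĝ` pivot-blind
(e.g. the explicit product chart of ✓`exists_fibredChart_iter_cont_blind_prod` carried to the window by ✓`fibredLaw_transport`).  Then `c.jac = Ĝ` almost everywhere for
`μ_J⌊O ⊗ ν_K`. [cite: Balaban1987RG1, (0.4) p.253 and (2.10) p.267] [cite: Bogachev2007, Thm 2.5.3] -/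
theorem windowChart_jac_ae_eq {S : Set (GaugeField (F.P K) 0 (Matrix.specialUnitaryGroup (Fin 2) ℂ))}
    {O : Set (GaugeField (F.P J) 0 (Matrix.specialUnitaryGroup (Fin 2) ℂ))} (hO : MeasurableSet O)
    (c : Summit.QuantumFields.YangMills.Theorems.FluctuationComparisonRegPrIntLWregGlue.WindowChart F hJK S O)
    {κ : Type*} (β : κ → PBond (F.P K) 0)
    (hoff : ∀ V z, c.jac (V, z) ≠ 0 → ∀ b, (∀ k, β k ≠ b) → c.Φ (V, z) b = z b)
    (hjbl : ∀ V z (h : κ → Matrix.specialUnitaryGroup (Fin 2) ℂ), c.jac (V, extend β h z) = c.jac (V, z))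
    {Ψ' : GaugeField (F.P J) 0 (Matrix.specialUnitaryGroup (Fin 2) ℂ) × GaugeField (F.P K) 0 (Matrix.specialUnitaryGroup (Fin 2) ℂ) →
      GaugeField (F.P K) 0 (Matrix.specialUnitaryGroup (Fin 2) ℂ)}
    {G' : GaugeField (F.P J) 0 (Matrix.specialUnitaryGroup (Fin 2) ℂ) × GaugeField (F.P K) 0 (Matrix.specialUnitaryGroup (Fin 2) ℂ) → ℝ≥0∞}
    (hΨ' : Measurable Ψ') (hG' : Measurable G')
    (hlaw' : (fieldMeasure (F.P K) 0 (Matrix.specialUnitaryGroup (Fin 2) ℂ)).restrict (descendTo F ℰp J K hJK ⁻¹' O ∩ S) =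
      ((((fieldMeasure (F.P J) 0 (Matrix.specialUnitaryGroup (Fin 2) ℂ)).restrict O).prod
        (fieldMeasure (F.P K) 0 (Matrix.specialUnitaryGroup (Fin 2) ℂ))).withDensity G').map Ψ')
    (hfib' : ∀ p, G' p ≠ 0 → descendTo F ℰp J K hJK (Ψ' p) = p.1)
    (hpiv' : ∀ p, G' p ≠ 0 → ∃ h : κ → Matrix.specialUnitaryGroup (Fin 2) ℂ, Ψ' p = extend β h p.2)
    (hGbl : ∀ (h : κ → Matrix.specialUnitaryGroup (Fin 2) ℂ) p, G' (p.1, extend β h p.2) = G' p) :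
    (fun p => (c.jac p : ℝ≥0∞)) =ᵐ[((fieldMeasure (F.P J) 0 (Matrix.specialUnitaryGroup (Fin 2) ℂ)).restrict O).prod
        (fieldMeasure (F.P K) 0 (Matrix.specialUnitaryGroup (Fin 2) ℂ))] G' := by
  set M := ((fieldMeasure (F.P J) 0 (Matrix.specialUnitaryGroup (Fin 2) ℂ)).restrict O).prod
        (fieldMeasure (F.P K) 0 (Matrix.specialUnitaryGroup (Fin 2) ℂ)) with hM
  have hDm : Measurable (descendTo F ℰp J K hJK) := measurable_descendTo F ℰp measurableE_ℰp hJK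
  -- `M`-a.e. the datum lies in `O`
  have hO' : ∀ᵐ p ∂M, p.1 ∈ O := by
    have hset : MeasurableSet {p : GaugeField (F.P J) 0 (Matrix.specialUnitaryGroup (Fin 2) ℂ) ×
        GaugeField (F.P K) 0 (Matrix.specialUnitaryGroup (Fin 2) ℂ) | p.1 ∈ O} := measurable_fst hO
    refine (Measure.ae_prod_iff_ae_ae hset).2 ?_
    filter_upwards [ae_restrict_mem hO] with V hV
    exact Filter.Eventually.of_forall fun _ => hV
  have hfib : ∀ᵐ p ∂M, (c.jac p : ℝ≥0∞) ≠ 0 → descendTo F ℰp J K hJK (c.Φ p) = p.1 := by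
    filter_upwards [hO'] with p hp hj
    exact c.descendTo_Φ p.1 hp p.2 (by exact_mod_cast hj)
  have hpiv : ∀ᵐ p ∂M, (c.jac p : ℝ≥0∞) ≠ 0 → ∃ h : κ → Matrix.specialUnitaryGroup (Fin 2) ℂ, c.Φ p = extend β h p.2 := by
    refine Filter.Eventually.of_forall fun p hj => ⟨fun k => c.Φ p (β k), ?_⟩
    have hj' : c.jac (p.1, p.2) ≠ 0 := by exact_mod_cast hj
    funext b
    by_cases hb : ∃ k, β k = b
    · classical
      rw [Function.extend_def, dif_pos hb]
      exact congrArg (c.Φ p) (Classical.choose_spec hb).symm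
    · rw [extend_apply' _ _ _ hb]
      exact hoff p.1 p.2 hj' b fun k hk => hb ⟨k, hk⟩
  have hfin : ∫⁻ p, (c.jac p : ℝ≥0∞) ∂M ≠ ∞ := by
    refine ne_top_of_le_ne_top ?_ (lintegral_mono fun p => ENNReal.coe_le_coe.2 (c.jac_le p))
    rw [lintegral_const]
    exact ENNReal.mul_ne_top ENNReal.coe_ne_top (measure_ne_top M _)
  exact ae_eq_of_two_laws hDm β c.measurable_Φ hΨ' c.measurable_jac.coe_nnreal_ennreal hG' c.map_Φ hlaw' hfib hpiv
    (Filter.Eventually.of_forall hfib') (Filter.Eventually.of_forall hpiv')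
    (fun h p => by exact_mod_cast hjbl p.1 p.2 h) hGbl hfin

end Window

end Summit.QuantumFields.YangMills.Theorems.FluctuationComparisonRegPrIntLS2BetaChartJacPinningAE

end
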